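import Literature.NumberTheory.Transcendental.RoySmallValueUnmixed
import Literature.NumberTheory.Transcendental.RoySmallValuePhiPoly
import HarnessLib

/-!
# Roy's small value estimate for `𝔾ₐ × 𝔾ₘ` — factorisation of `F = Φ(P, Q, ·)` into linear forms

Topic `Literature/NumberTheory/Transcendental`. Part of the formalisation of the proof of Roy 2013,
Theorem 1.1 (named fact `roy2013_thm_1_1`, `RoySmallValueEstimates.lean`). Source: D. Roy,
*A small value estimate for `𝔾ₐ × 𝔾ₘ`*, Mathematika 59 (2013) 333–363 = arXiv:1301.0663, §6,
proof of Proposition 6.4 (p. 17 of the arXiv text):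

> [...] choose a system of representatives `α₁, …, α_t ∈ ℂ³ ∖ {0}` of the points of
> `𝒵(P, Q)(ℂ)`. Then, there exist `a ∈ ℂ^×` and `e₁, …, e_t ∈ ℕ*` such that
> `F(R) = a R(α₁)^{e₁} ⋯ R(α_t)^{e_t}` [...] for each `R ∈ ℂ[X]_D`.

There `F(R) = Res_D(P, Q, R)`; here `F = royF` is `Φ(P, Q, ·)` as a polynomial in the
coefficients `r = (r_ν)_{|ν| = D}` of `R` (`RoySmallValuePhiPoly`), and we PROVE the displayed
factorisation for it (`royF_eq_C_mul_prod`): with `ℓ_α(r) = ∑_ν α^ν r_ν` (`evalForm`, so that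
`ℓ_α(r) = R(α)`), and `α₁, …, αₘ` representatives of `𝒵(P, Q)` (`exists_common_zero_reprs`),
`F = c ∏ᵢ ℓ_{αᵢ}^{eᵢ}` with `c ≠ 0`, `eᵢ ≥ 1` the exact multiplicities, and `∑ eᵢ = deg F = #M₂`.
Ingredients: `Φ(P, Q, R) = 0` iff `R` meets `𝒵(P, Q)` (`royPhi_eq_zero_iff_common_zero`, the
unmixedness of `RoySmallValueUnmixed`); a polynomial vanishing on the hyperplane `ℓ_α = 0` is
divisible by the (prime) linear form `ℓ_α`, and the cofactor of `∏ ℓ_{αᵢ}^{eᵢ}` has no zeros, hence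
is constant — both by Hilbert's Nullstellensatz on the coefficient space (Mathlib). Everything here
is proved; no named facts.

## References

* [Roy2013] D. Roy, *A small value estimate for 𝔾ₐ × 𝔾ₘ*, Mathematika 59 (2013), 333–363
  (arXiv:1301.0663), §6, proof of Proposition 6.4 (display (6.4)); §2 (Chow forms of
  zero-dimensional varieties factor into linear forms, proof of Proposition 2.3).
-/

noncomputable section

open MvPolynomial Finset Module

namespace Literature.NumberTheory.Transcendental

namespace Roy2013

variable {D : ℕ} {M₁ M₂ : Finset (Fin 3 →₀ ℕ)}

/-- Indices of the coefficients of a ternary form of degree `D`. [cite: Roy2013, §2] -/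
abbrev CoefIdx (D : ℕ) : Type := ↥(finsuppAntidiag (univ : Finset (Fin 3)) D)

/-! ### The linear forms `ℓ_α(r) = R(α)` and the form `R_r` with coefficients `r` -/

/-- **`ℓ_α`**: the linear form `r ↦ R(α) = ∑_ν α^ν r_ν` on the coefficients of `R ∈ ℂ[X]_D`.
[cite: Roy2013, §6, proof of Proposition 6.4 (`R ↦ R(αᵢ)`)] -/
def evalForm (D : ℕ) (α : Fin 3 → ℂ) : MvPolynomial (CoefIdx D) ℂ :=
  ∑ ν : CoefIdx D, C (∏ k, α k ^ (ν.1 k)) * X ν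

/-- **`R_r`**: the form of degree `D` with coefficient vector `r`. [cite: Roy2013, §2] -/
def formOf (r : CoefIdx D → ℂ) : CX := ∑ ν : CoefIdx D, r ν • monomial ν.1 (1 : ℂ)

/-- Coefficients of `R_r`. [folklore] -/
theorem coeff_formOf (r : CoefIdx D → ℂ) (ν : CoefIdx D) : coeff ν.1 (formOf r) = r ν :=
  coeff_sum_smul_monomial _ r ν

/-- The coefficient vector of `R_r` is `r`. [folklore] -/
theorem coeffFun_formOf (r : CoefIdx D → ℂ) : (fun ν : CoefIdx D => coeff ν.1 (formOf r)) = r :=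
  funext (coeff_formOf r)

/-- `R_r ∈ ℂ[X]_D`. [folklore] -/
theorem isHomogeneous_formOf (r : CoefIdx D → ℂ) : (formOf r).IsHomogeneous D :=
  IsHomogeneous.sum _ _ _ fun ν _ =>
    (homogeneousSubmodule (Fin 3) ℂ D).smul_mem _
      (isHomogeneous_monomial _ (degree_of_mem_finsuppAntidiag ν.2))

/-- A form of degree `D` is `R_r` for its own coefficient vector. [folklore] -/
theorem formOf_coeff {R : CX} (hR : R.IsHomogeneous D) :
    formOf (fun ν : CoefIdx D => coeff ν.1 R) = R := by
  classical
  have hsupp : ∀ ν ∈ R.support, ν ∈ finsuppAntidiag (univ : Finset (Fin 3)) D := by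
    intro ν hν
    rw [mem_finsuppAntidiag]
    refine ⟨?_, by simp⟩
    have h1 : ν.degree = D := by
      rw [Finsupp.degree_eq_weight_one]; exact hR (mem_support_iff.mp hν)
    rwa [Finsupp.degree_eq_sum] at h1
  rw [formOf]
  conv_rhs => rw [R.as_sum]
  rw [Finset.sum_coe_sort (finsuppAntidiag (univ : Finset (Fin 3)) D)
    (fun ν => coeff ν R • monomial ν (1 : ℂ))]
  rw [← Finset.sum_subset hsupp (fun ν _ hν => by
    rw [notMem_support_iff.mp hν, zero_smul])]
  exact Finset.sum_congr rfl fun ν _ => by rw [smul_monomial, smul_eq_mul, mul_one]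

/-- `ℓ_α(r) = ∑_ν α^ν r_ν`. [folklore] -/
theorem eval_evalForm (α : Fin 3 → ℂ) (r : CoefIdx D → ℂ) :
    eval r (evalForm D α) = ∑ ν : CoefIdx D, (∏ k, α k ^ (ν.1 k)) * r ν := by
  simp only [evalForm, map_sum, map_mul, eval_C, eval_X]

/-- **`ℓ_α(r) = R(α)`** for the coefficient vector `r` of `R ∈ ℂ[X]_D`.
[cite: Roy2013, §6, proof of Proposition 6.4] -/
theorem eval_evalForm_coeff {R : CX} (hR : R.IsHomogeneous D) (α : Fin 3 → ℂ) :
    eval (fun ν : CoefIdx D => coeff ν.1 R) (evalForm D α) = eval α R := by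
  classical
  rw [eval_evalForm]
  conv_rhs => rw [← formOf_coeff hR, formOf, map_sum]
  refine Finset.sum_congr rfl fun ν _ => ?_
  rw [smul_eq_C_mul, map_mul, eval_C, eval_monomial, one_mul, mul_comm, Finsupp.prod]
  congr 1
  exact (Finset.prod_subset (Finset.subset_univ _) fun k _ hk => by
    rw [Finsupp.notMem_support_iff.mp hk, pow_zero]).symm

/-- `ℓ_α(r) = R_r(α)`. [folklore] -/
theorem eval_evalForm_eq_eval_formOf (α : Fin 3 → ℂ) (r : CoefIdx D → ℂ) :
    eval r (evalForm D α) = eval α (formOf r) := by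
  rw [← eval_evalForm_coeff (isHomogeneous_formOf r), coeffFun_formOf]

/-- `ℓ_α` is a linear form. [folklore] -/
theorem isHomogeneous_evalForm (α : Fin 3 → ℂ) : (evalForm D α).IsHomogeneous 1 :=
  IsHomogeneous.sum _ _ _ fun ν _ => (isHomogeneous_X ℂ ν).C_mul _

/-- Its coefficients. [folklore] -/
theorem coeff_evalForm_single (α : Fin 3 → ℂ) (ν : CoefIdx D) :
    coeff (Finsupp.single ν 1) (evalForm D α) = ∏ k, α k ^ (ν.1 k) := by
  classical
  rw [evalForm, coeff_sum, Finset.sum_eq_single ν]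
  · rw [coeff_C_mul, coeff_X, if_pos rfl, mul_one]
  · intro μ _ hμ
    rw [coeff_C_mul, coeff_X, if_neg (fun h => hμ (Finsupp.single_left_injective one_ne_zero h)),
      mul_zero]
  · exact fun h => absurd (Finset.mem_univ ν) h

/-- The exponent `D e_k`. [folklore] -/
theorem single_mem_finsuppAntidiag (k : Fin 3) :
    Finsupp.single k D ∈ finsuppAntidiag (univ : Finset (Fin 3)) D := by
  rw [mem_finsuppAntidiag]
  exact ⟨by simp [Finsupp.single_apply], Finset.subset_univ _⟩

/-- `ℓ_α ≠ 0` for `α ≠ 0`. [folklore] -/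
theorem evalForm_ne_zero {α : Fin 3 → ℂ} (hα : α ≠ 0) : evalForm D α ≠ 0 := by
  obtain ⟨k, hk⟩ : ∃ k, α k ≠ 0 := by
    by_contra h0
    exact hα (funext fun k => by simpa using not_exists.mp h0 k)
  intro h
  have h1 := coeff_evalForm_single α (⟨Finsupp.single k D, single_mem_finsuppAntidiag k⟩ : CoefIdx D)
  rw [h, coeff_zero] at h1
  refine pow_ne_zero D hk ?_
  rw [h1, ← Finset.prod_subset (Finset.subset_univ {k}) (fun j _ hj => by
    rw [Finsupp.single_apply, if_neg (fun h' => hj (by rw [h']; exact mem_singleton_self _)),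
      pow_zero]), Finset.prod_singleton, Finsupp.single_eq_same]

/-! ### Linear forms are prime; vanishing on `ℓ = 0` means divisibility by `ℓ` -/

/-- A nonzero linear form is irreducible. [folklore] -/
theorem irreducible_of_isHomogeneous_one {τ : Type*} {ℓ : MvPolynomial τ ℂ}
    (hℓ : ℓ.IsHomogeneous 1) (h0 : ℓ ≠ 0) : Irreducible ℓ := by
  have hdeg : ℓ.totalDegree = 1 := hℓ.totalDegree h0
  refine ⟨fun hu => ?_, fun a b hab => ?_⟩
  · rw [isUnit_iff_totalDegree_of_isReduced] at hu
    omega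
  · have ha0 : a ≠ 0 := fun h => h0 (by rw [hab, h, zero_mul])
    have hb0 : b ≠ 0 := fun h => h0 (by rw [hab, h, mul_zero])
    have hsum : a.totalDegree + b.totalDegree = 1 := by
      rw [← totalDegree_mul_of_isDomain ha0 hb0, ← hab, hdeg]
    rcases Nat.eq_zero_or_pos a.totalDegree with ha | ha
    · left
      rw [isUnit_iff_totalDegree_of_isReduced]
      refine ⟨isUnit_iff_ne_zero.mpr fun hc => ha0 ?_, ha⟩
      rw [totalDegree_eq_zero_iff_eq_C.mp ha, hc, C_0]
    · right
      have hb : b.totalDegree = 0 := by omega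
      rw [isUnit_iff_totalDegree_of_isReduced]
      refine ⟨isUnit_iff_ne_zero.mpr fun hc => hb0 ?_, hb⟩
      rw [totalDegree_eq_zero_iff_eq_C.mp hb, hc, C_0]

/-- **A polynomial vanishing wherever the linear form `ℓ_α` vanishes is divisible by `ℓ_α`**
(Nullstellensatz: it lies in the radical of the prime ideal `(ℓ_α)`). [folklore] -/
theorem evalForm_dvd_of_forall_eval_eq_zero {α : Fin 3 → ℂ} (hα : α ≠ 0)
    {G : MvPolynomial (CoefIdx D) ℂ}
    (hG : ∀ r : CoefIdx D → ℂ, eval r (evalForm D α) = 0 → eval r G = 0) : evalForm D α ∣ G := by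
  have hprime : Prime (evalForm D α) :=
    (irreducible_of_isHomogeneous_one (isHomogeneous_evalForm α) (evalForm_ne_zero hα)).prime
  have hrad : G ∈ (Ideal.span {evalForm D α}).radical := by
    rw [← MvPolynomial.vanishingIdeal_zeroLocus_eq_radical (K := ℂ), mem_vanishingIdeal_iff]
    intro r hr
    rw [zeroLocus_span] at hr
    exact hG r (hr _ (Set.mem_singleton _))
  obtain ⟨n, hn⟩ := Ideal.mem_radical_iff.mp hrad
  exact hprime.dvd_of_dvd_pow (Ideal.mem_span_singleton.mp hn)

/-- Linear forms of non-proportional points are not associated. [folklore] -/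
theorem not_evalForm_dvd_evalForm (hD : 1 ≤ D) {α β : Fin 3 → ℂ} (hα : α ≠ 0) (hβ : β ≠ 0)
    (h : ¬∃ t : ℂ, β = t • α) : ¬evalForm D α ∣ evalForm D β := by
  rintro ⟨u, hu⟩
  have hu0 : u ≠ 0 := fun h0 => evalForm_ne_zero hβ (by rw [hu, h0, mul_zero])
  -- `u` is a nonzero constant
  have hdeg : u.totalDegree = 0 := by
    have h1 := (isHomogeneous_evalForm (D := D) β).totalDegree (evalForm_ne_zero hβ)
    rw [hu, totalDegree_mul_of_isDomain (evalForm_ne_zero hα) hu0,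
      (isHomogeneous_evalForm (D := D) α).totalDegree (evalForm_ne_zero hα)] at h1
    omega
  obtain hC := totalDegree_eq_zero_iff_eq_C.mp hdeg
  set c := coeff 0 u with hc
  -- compare coefficients: `β^ν = c α^ν` for all `|ν| = D`
  have hcoef : ∀ ν : CoefIdx D, (∏ k, β k ^ (ν.1 k)) = c * ∏ k, α k ^ (ν.1 k) := by
    intro ν
    rw [← coeff_evalForm_single β ν, hu, hC, mul_comm, coeff_C_mul, coeff_evalForm_single]
  -- pick `k₀` with `β k₀ ≠ 0`; then `α k₀ ≠ 0`
  obtain ⟨k₀, hk₀⟩ : ∃ k, β k ≠ 0 := by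
    by_contra h0
    exact hβ (funext fun k => by simpa using not_exists.mp h0 k)
  have hpow : ∀ (γ : Fin 3 → ℂ) (k : Fin 3) (n : ℕ),
      (∏ j, γ j ^ ((Finsupp.single k n : Fin 3 →₀ ℕ) j)) = γ k ^ n := by
    intro γ k n
    rw [← Finset.prod_subset (Finset.subset_univ {k}) (fun j _ hj => by
      rw [Finsupp.single_apply, if_neg (fun h' => hj (by rw [h']; exact mem_singleton_self _)),
        pow_zero]), Finset.prod_singleton, Finsupp.single_eq_same]
  have h1 := hcoef ⟨Finsupp.single k₀ D, single_mem_finsuppAntidiag k₀⟩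
  simp only [hpow] at h1
  have hαk₀ : α k₀ ≠ 0 := by
    intro h0
    rw [h0, zero_pow (by omega), mul_zero] at h1
    exact pow_ne_zero D hk₀ h1
  -- mixed exponents `(D-1) e_{k₀} + e_k`
  have hmix : ∀ k, β k₀ ^ (D - 1) * β k = c * (α k₀ ^ (D - 1) * α k) := by
    intro k
    have hmem : Finsupp.single k₀ (D - 1) + Finsupp.single k 1 ∈
        finsuppAntidiag (univ : Finset (Fin 3)) D := by
      rw [mem_finsuppAntidiag]
      refine ⟨?_, Finset.subset_univ _⟩
      rw [← Finsupp.degree_eq_sum, map_add, Finsupp.degree_single, Finsupp.degree_single]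
      omega
    have h2 := hcoef ⟨_, hmem⟩
    simp only [Finsupp.coe_add, Pi.add_apply, pow_add, Finset.prod_mul_distrib, hpow, pow_one] at h2
    exact h2
  -- conclude proportionality: `β_k α_{k₀} = β_{k₀} α_k`
  refine h ⟨β k₀ / α k₀, funext fun k => ?_⟩
  rw [Pi.smul_apply, smul_eq_mul]
  have h3 := hmix k
  have hβpow : β k₀ ^ (D - 1) ≠ 0 := pow_ne_zero _ hk₀
  have eD : α k₀ ^ D = α k₀ ^ (D - 1) * α k₀ := by rw [← pow_succ, Nat.sub_add_cancel hD]
  have eD' : β k₀ ^ D = β k₀ ^ (D - 1) * β k₀ := by rw [← pow_succ, Nat.sub_add_cancel hD]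
  have key : β k₀ ^ (D - 1) * (β k * α k₀) = β k₀ ^ (D - 1) * (β k₀ * α k) := by
    calc β k₀ ^ (D - 1) * (β k * α k₀) = (β k₀ ^ (D - 1) * β k) * α k₀ := by ring
      _ = c * (α k₀ ^ (D - 1) * α k) * α k₀ := by rw [h3]
      _ = (c * α k₀ ^ D) * α k := by rw [eD]; ring
      _ = β k₀ ^ D * α k := by rw [← h1]
      _ = β k₀ ^ (D - 1) * (β k₀ * α k) := by rw [eD']; ring
  have key2 := mul_left_cancel₀ hβpow key
  field_simp
  linear_combination key2

/-! ### The factorisation -/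

/-- `ℓ^k ∣ F ≠ 0` forces `k ≤ deg F`. [folklore] -/
theorem le_totalDegree_of_pow_dvd {τ : Type*} {ℓ F : MvPolynomial τ ℂ} (hℓ : ℓ.IsHomogeneous 1)
    (hℓ0 : ℓ ≠ 0) (hF0 : F ≠ 0) {k : ℕ} (hk : ℓ ^ k ∣ F) : k ≤ F.totalDegree := by
  obtain ⟨G, rfl⟩ := hk
  have hG0 : G ≠ 0 := right_ne_zero_of_mul hF0
  have hpk : (ℓ ^ k).IsHomogeneous k := by simpa using hℓ.pow k
  rw [totalDegree_mul_of_isDomain (pow_ne_zero _ hℓ0) hG0, hpk.totalDegree (pow_ne_zero _ hℓ0)]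
  omega

/-- **Roy 2013, display (6.4), for `F = Φ(P, Q, ·)`.** Let `P, Q` be coprime ternary forms of
degree `D ≥ 1`, `Φ` the determinant on complements as in Lemma 5.1, `F(r) = Φ(P, Q, R_r)`, and
`α₁, …, αₘ` representatives of the points of `𝒵(P, Q)`. Then there are `c ≠ 0` and integers
`eᵢ ≥ 1` with `F = c ∏ᵢ ℓ_{αᵢ}^{eᵢ}`, `∑ eᵢ = deg F = #M₂`, and `eᵢ` is the exact multiplicity of
`ℓ_{αᵢ}` in `F`. [cite: Roy2013, §6, proof of Proposition 6.4, (6.4)] -/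
theorem royF_eq_C_mul_prod {P Q : CX} (hP : P.IsHomogeneous D) (hQ : Q.IsHomogeneous D)
    (hD : 1 ≤ D) (hP0 : P ≠ 0) (hQ0 : Q ≠ 0)
    (hPQ : ∀ f : CX, Q * f ∈ Ideal.span {P} → f ∈ Ideal.span {P})
    (hM₁ : ∀ μ ∈ M₁, μ.degree = 2 * D) (hM₂ : ∀ μ ∈ M₂, μ.degree = 2 * D)
    (hE₁i : Submodule.span ℂ ((fun μ => monomial μ (1 : ℂ)) '' (M₁ : Set (Fin 3 →₀ ℕ))) ⊓
      (homogeneousSubmodule (Fin 3) ℂ D).map (LinearMap.mulLeft ℂ P) = ⊥)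
    (hE₁s : Submodule.span ℂ ((fun μ => monomial μ (1 : ℂ)) '' (M₁ : Set (Fin 3 →₀ ℕ))) ⊔
      (homogeneousSubmodule (Fin 3) ℂ D).map (LinearMap.mulLeft ℂ P) =
      homogeneousSubmodule (Fin 3) ℂ (2 * D))
    (hE₂i : Submodule.span ℂ ((fun μ => monomial μ (1 : ℂ)) '' (M₂ : Set (Fin 3 →₀ ℕ))) ⊓
      ((homogeneousSubmodule (Fin 3) ℂ D).map (LinearMap.mulLeft ℂ P) ⊔
        (homogeneousSubmodule (Fin 3) ℂ D).map (LinearMap.mulLeft ℂ Q)) = ⊥)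
    (hE₂s : Submodule.span ℂ ((fun μ => monomial μ (1 : ℂ)) '' (M₂ : Set (Fin 3 →₀ ℕ))) ⊔
      ((homogeneousSubmodule (Fin 3) ℂ D).map (LinearMap.mulLeft ℂ P) ⊔
        (homogeneousSubmodule (Fin 3) ℂ D).map (LinearMap.mulLeft ℂ Q)) =
      homogeneousSubmodule (Fin 3) ℂ (2 * D))
    (σ : PhiCol D M₁ M₂ ≃ PhiRow D)
    {m : ℕ} (α : Fin m → (Fin 3 → ℂ)) (hα0 : ∀ i, α i ≠ 0)
    (hz : ∀ i, eval (α i) P = 0 ∧ eval (α i) Q = 0)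
    (hsep : ∀ i j, i ≠ j → ¬∃ t : ℂ, α j = t • α i)
    (hcov : ∀ β : Fin 3 → ℂ, β ≠ 0 → eval β P = 0 → eval β Q = 0 → ∃ i, ∃ t : ℂ, β = t • α i) :
    ∃ (c : ℂ) (e : Fin m → ℕ), c ≠ 0 ∧ (∀ i, 1 ≤ e i) ∧ ∑ i, e i = M₂.card ∧
      royF D M₁ M₂ σ P Q = C c * ∏ i, evalForm D (α i) ^ e i ∧
      ∀ i k, evalForm D (α i) ^ k ∣ royF D M₁ M₂ σ P Q → k ≤ e i := by
  classical
  set F := royF D M₁ M₂ σ P Q with hFdef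
  set ℓ : Fin m → MvPolynomial (CoefIdx D) ℂ := fun i => evalForm D (α i) with hℓdef
  -- `F ≠ 0`
  obtain ⟨a, b, -, hh⟩ := exists_regular_lineForm_pow hP hQ hD hP0 hQ0 hPQ
  have hR₀ : (lineForm a b ^ D).IsHomogeneous D := by
    have h := (((isHomogeneous_X ℂ (0 : Fin 3)).sub
      (((isHomogeneous_X ℂ (1 : Fin 3)).C_mul a).add ((isHomogeneous_X ℂ (2 : Fin 3)).C_mul b))).pow D)
    rw [one_mul] at h
    exact h
  have hF0 : F ≠ 0 := royF_ne_zero hM₁ hM₂ σ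
    (royPhi_ne_zero hP hQ hR₀ hP0 hQ0 hPQ (hh D) hM₁ hM₂ hE₁i hE₁s hE₂i hE₂s σ)
  -- values of `F`
  have hFval : ∀ r : CoefIdx D → ℂ, eval r F = royPhi D M₁ M₂ σ ![P, Q, formOf r] := by
    intro r
    rw [hFdef, ← coeffFun_formOf r, eval_royF hM₁ hM₂]
    rw [coeffFun_formOf]
  have hℓ0 : ∀ i, ℓ i ≠ 0 := fun i => evalForm_ne_zero (hα0 i)
  have hℓirr : ∀ i, Irreducible (ℓ i) := fun i =>
    irreducible_of_isHomogeneous_one (isHomogeneous_evalForm _) (hℓ0 i)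
  -- each `ℓᵢ` divides `F`
  have hℓdvd : ∀ i, ℓ i ∣ F := by
    intro i
    refine evalForm_dvd_of_forall_eval_eq_zero (hα0 i) fun r hr => ?_
    rw [hFval]
    refine royPhi_eq_zero_of_common_zero hM₁ hM₂ σ
      (Fin.forall_fin_succ.mpr ⟨hP, Fin.forall_fin_two.mpr ⟨hQ, isHomogeneous_formOf r⟩⟩) (hα0 i)
      (Fin.forall_fin_succ.mpr ⟨(hz i).1, Fin.forall_fin_two.mpr ⟨(hz i).2, ?_⟩⟩)
    change eval (α i) (formOf r) = 0
    rw [← eval_evalForm_eq_eval_formOf]; exact hr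
  -- exact multiplicities
  set e : Fin m → ℕ := fun i => Nat.findGreatest (fun k => ℓ i ^ k ∣ F) F.totalDegree with hedef
  have hedvd : ∀ i, ℓ i ^ e i ∣ F := fun i =>
    Nat.findGreatest_spec (P := fun k => ℓ i ^ k ∣ F) (Nat.zero_le _) (by simp)
  have hemax : ∀ i k, ℓ i ^ k ∣ F → k ≤ e i := fun i k hk =>
    Nat.le_findGreatest (le_totalDegree_of_pow_dvd (isHomogeneous_evalForm _) (hℓ0 i) hF0 hk) hk
  have he1 : ∀ i, 1 ≤ e i := fun i => hemax i 1 (by rw [pow_one]; exact hℓdvd i)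
  -- pairwise coprime, so the product divides
  have hrel : Pairwise fun i j => IsRelPrime (ℓ i ^ e i) (ℓ j ^ e j) := by
    intro i j hij
    refine IsRelPrime.pow ((hℓirr i).isRelPrime_iff_not_dvd.mpr ?_)
    exact not_evalForm_dvd_evalForm hD (hα0 i) (hα0 j) (hsep i j hij)
  obtain ⟨H, hH⟩ := Fintype.prod_dvd_of_isRelPrime hrel hedvd
  have hH0 : H ≠ 0 := fun h => hF0 (by rw [hH, h, mul_zero])
  -- `ℓᵢ ∤ H`
  have hℓH : ∀ i, ¬ℓ i ∣ H := by
    intro i hi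
    have h1 : ℓ i ^ (e i + 1) ∣ F := by
      obtain ⟨H', rfl⟩ := hi
      rw [hH, ← Finset.mul_prod_erase univ (fun j => ℓ j ^ e j) (mem_univ i)]
      exact ⟨(∏ j ∈ univ.erase i, ℓ j ^ e j) * H', by ring⟩
    have := hemax i _ h1
    omega
  -- zeros of `H` lie on the hyperplanes `ℓᵢ = 0`
  have hHzero : ∀ r : CoefIdx D → ℂ, eval r H = 0 → ∃ i, eval r (ℓ i) = 0 := by
    intro r hr
    have hFr : royPhi D M₁ M₂ σ ![P, Q, formOf r] = 0 := by
      rw [← hFval, hH, map_mul, hr, mul_zero]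
    obtain ⟨β, hβ, h1, h2, h3⟩ := (royPhi_eq_zero_iff_common_zero hP hQ (isHomogeneous_formOf r)
      hD hP0 hQ0 hPQ hM₁ hM₂ hE₁i hE₁s hE₂i hE₂s σ).mp hFr
    obtain ⟨i, t, rfl⟩ := hcov β hβ h1 h2
    have ht : t ≠ 0 := fun h => hβ (by rw [h, zero_smul])
    refine ⟨i, ?_⟩
    rw [eval_evalForm_eq_eval_formOf]
    have h4 : eval (t • α i) (formOf r) = t ^ D * eval (α i) (formOf r) :=
      aeval_smul_of_isHomogeneous (isHomogeneous_formOf r) t (α i)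
    rw [h4] at h3
    exact (mul_eq_zero.mp h3).resolve_left (pow_ne_zero _ ht)
  -- hence `H` is a unit (Nullstellensatz + UFD)
  have hHunit : IsUnit H := by
    by_contra hu
    obtain ⟨q, hqirr, hqH⟩ := WfDvdMonoid.exists_irreducible_factor hu hH0
    have hrad : (∏ i, ℓ i) ∈ (Ideal.span {H}).radical := by
      rw [← MvPolynomial.vanishingIdeal_zeroLocus_eq_radical (K := ℂ), mem_vanishingIdeal_iff]
      intro r hr
      rw [zeroLocus_span] at hr
      obtain ⟨i, hi⟩ := hHzero r (hr _ (Set.mem_singleton _))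
      change eval r (∏ i, ℓ i) = 0
      rw [map_prod]
      exact Finset.prod_eq_zero (mem_univ i) hi
    obtain ⟨n, hn⟩ := Ideal.mem_radical_iff.mp hrad
    have hqprod : q ∣ ∏ i, ℓ i :=
      hqirr.prime.dvd_of_dvd_pow (hqH.trans (Ideal.mem_span_singleton.mp hn))
    obtain ⟨i, -, hqi⟩ := hqirr.prime.exists_mem_finset_dvd hqprod
    exact hℓH i (((hqirr.associated_of_dvd (hℓirr i) hqi).dvd_iff_dvd_left).mp hqH)
  obtain ⟨c, hcu, hHc⟩ := isUnit_iff_eq_C_of_isReduced.mp hHunit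
  have hc0 : c ≠ 0 := hcu.ne_zero
  -- degree count
  have hFh : F.IsHomogeneous M₂.card := isHomogeneous_royF σ P Q
  have hPh : (C c * ∏ i, ℓ i ^ e i).IsHomogeneous (∑ i, e i) := by
    have h := (isHomogeneous_C (CoefIdx D) c).mul
      (IsHomogeneous.prod univ (fun i => ℓ i ^ e i) e fun i _ => by
        simpa using (isHomogeneous_evalForm (D := D) (α i)).pow (e i))
    rwa [zero_add] at h
  have hFeq : F = C c * ∏ i, ℓ i ^ e i := by rw [hH, hHc, mul_comm]
  rw [hFeq] at hFh
  have hsum : ∑ i, e i = M₂.card :=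
    IsHomogeneous.inj_right hPh hFh (by rw [← hFeq]; exact hF0)
  exact ⟨c, e, hc0, he1, hsum, hFeq, hemax⟩

end Roy2013

end Literature.NumberTheory.Transcendental
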